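import Summits.CriticalPhenomena.CardyFormulaZ2.Theses.DyadicBetaRigidity
import Summits.CriticalPhenomena.SAWScalingLimit.Theorems.SAWLeftRightFKGLeftRightFKGStubMeshReduction
import Literature.Probability.Percolation.CardyFormula
import Literature.Probability.Percolation.QuadCrossingSpaceZ2
import Literature.Probability.RandomPlanarGeometry.ImageUnivalent

/-!
# Exact dilation covariance of the G02 discretisation of bond-`ℤ²` crossing probabilities

Support file for `DyadicBetaSuffices` (route DyadicBetaRigidity of `CardyFormulaZ2`, item
stmt-CriticalPhenomena-18184).

Mesh points scale with the mesh (`meshPoint_mul` of `QuadCrossingSpaceZ2`), and the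
largest-component rule only sees the vertex set and the mesh graph (`meshDomain_congr` of
`SAWLeftRightFKGLeftRightFKGStubMeshReduction`); both are imported, not restated.
For a real factor `c > 0`, the site set `δℤ² ∩ Ω` seen at mesh `δ` and the site set
`(cδ)ℤ² ∩ cΩ` seen at mesh `cδ` are the SAME subset of `ℤ²`; the mesh graph, the largest
component `Ω_δ`, its vertex boundary, the discrete arcs (nearest-arc rule, distances scale by
`c`) and hence Smirnov's crossing event `C_δ(Ω; A, B)` are literally equal
(`discreteCrossing_smul`). Consequently the `P_{1/2}` bond crossing probability of the dilated
conformal rectangle `cR` at mesh `cδ` equals that of `R` at mesh `δ`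
(`bondDomainCrossingProb_dilate`). The lattice-polygon class of the route (frontier covered by
finitely many edges of `hℤ²`) is stable under mesh refinement `h ↦ h / N`
(`latticePolygon_refine`).

References: S. Smirnov, C. R. Acad. Sci. Paris 333 (2001), §2 (the discretisation);
B. Bollobás, O. Riordan, *Percolation* (2006), Ch. 7.
-/

noncomputable section

open scoped Pointwise

namespace Summit.CriticalPhenomena.CardyFormulaZ2.Theorems

namespace DyadicLattice

open Set Metric Filter Topology
open Literature.Probability.LatticeModels Literature.Probability.Percolation
open Literature.Probability.RandomPlanarGeometry

/-! ### Dilations of the plane and of mesh points -/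

/-- The dilate `c • s` of a set is its image under `z ↦ c z`. [folklore] -/
theorem smul_set_eq_image (c : ℂ) (s : Set ℂ) : c • s = (fun z ↦ c * z) '' s := rfl

/-- Dilation by a non-zero factor respects inclusions. [folklore] -/
theorem smul_set_subset_smul_set_iff {c : ℂ} (hc : c ≠ 0) {A B : Set ℂ} :
    c • A ⊆ c • B ↔ A ⊆ B := by
  rw [smul_set_eq_image, smul_set_eq_image]
  exact image_subset_image_iff (mul_right_injective₀ hc)

/-- Dilations map segments to segments. [folklore] -/
theorem smul_segment (c a b : ℂ) : c • segment ℝ a b = segment ℝ (c * a) (c * b) := by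
  rw [segment_eq_image', segment_eq_image', smul_set_eq_image, image_image]
  refine image_congr fun θ _ ↦ ?_
  simp only [Complex.real_smul]
  ring

/-- Dilations commute with set difference. [folklore] -/
theorem smul_set_diff {c : ℂ} (hc : c ≠ 0) (A B : Set ℂ) : c • (A \ B) = c • A \ c • B := by
  simp only [smul_set_eq_image]
  exact image_sdiff (mul_right_injective₀ hc) A B

/-- Dilations commute with the frontier. [folklore] -/
theorem frontier_smul {c : ℂ} (hc : c ≠ 0) (s : Set ℂ) : frontier (c • s) = c • frontier s := by
  have h := (Homeomorph.smulOfNeZero c hc).image_frontier s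
  exact h.symm

/-- Distances to sets scale under dilations: `d(cz, cA) = |c| d(z, A)`. [folklore] -/
theorem infDist_smul {c : ℂ} (hc : c ≠ 0) (z : ℂ) (A : Set ℂ) :
    infDist (c * z) (c • A) = ‖c‖ * infDist z A := by
  have := infDist_smul₀ hc A z
  simpa only [smul_eq_mul] using this

/-! ### The discretisation of a dilated domain -/

variable {c δ : ℝ} {Ω : Set ℂ}

/-- The mesh vertices of `cΩ` at mesh `cδ` are those of `Ω` at mesh `δ`. [folklore] -/
theorem meshVertices_smul (hc : c ≠ 0) (Ω : Set ℂ) (δ : ℝ) :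
    meshVertices ((c : ℂ) • Ω) (c * δ) = meshVertices Ω δ := by
  ext x
  rw [mem_meshVertices_iff, mem_meshVertices_iff, meshPoint_mul]
  exact smul_mem_smul_set_iff₀ (Complex.ofReal_ne_zero.2 hc) Ω _

/-- The mesh graph of `cΩ` at mesh `cδ` is that of `Ω` at mesh `δ`. [folklore] -/
theorem meshGraph_smul (hc : c ≠ 0) (Ω : Set ℂ) (δ : ℝ) :
    meshGraph ((c : ℂ) • Ω) (c * δ) = meshGraph Ω δ := by
  have hc' : (c : ℂ) ≠ 0 := Complex.ofReal_ne_zero.2 hc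
  ext x y
  rw [meshGraph_adj_iff, meshGraph_adj_iff, meshPoint_mul, meshPoint_mul, ← smul_segment,
    closure_smul₀ (c : ℂ) Ω, smul_set_subset_smul_set_iff hc']

/-- The discrete domain `(cΩ)_{cδ}` is `Ω_δ` (as a set of sites). [folklore] -/
theorem meshDomain_smul (hc : c ≠ 0) (Ω : Set ℂ) (δ : ℝ) :
    meshDomain ((c : ℂ) • Ω) (c * δ) = meshDomain Ω δ :=
  Summit.CriticalPhenomena.SAWScalingLimit.Theorems.LeftRightFKG.CornerLoc.meshDomain_congr
    (meshVertices_smul hc Ω δ) (meshGraph_smul hc Ω δ)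

/-- The graph `(cΩ)_{cδ}` is the graph `Ω_δ`. [folklore] -/
theorem discreteDomainGraph_smul (hc : c ≠ 0) (Ω : Set ℂ) (δ : ℝ) :
    discreteDomainGraph ((c : ℂ) • Ω) (c * δ) = discreteDomainGraph Ω δ := by
  ext x y
  rw [discreteDomainGraph_adj_iff, discreteDomainGraph_adj_iff, meshGraph_smul hc,
    meshDomain_smul hc]

/-- The vertex boundary of `(cΩ)_{cδ}` is that of `Ω_δ`. [folklore] -/
theorem meshBoundary_smul (hc : c ≠ 0) (Ω : Set ℂ) (δ : ℝ) :
    meshBoundary ((c : ℂ) • Ω) (c * δ) = meshBoundary Ω δ := by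
  ext x
  rw [mem_meshBoundary_iff, mem_meshBoundary_iff, meshDomain_smul hc, discreteDomainGraph_smul hc]

/-- The discrete arc of the dilated arc `cA ⊆ ∂(cΩ)` at mesh `cδ` is the discrete arc of `A` at
mesh `δ` (the nearest-arc rule is scale invariant). [folklore] -/
theorem discreteArc_smul (hc : 0 < c) (Ω : Set ℂ) (δ : ℝ) (A : Set ℂ) :
    discreteArc ((c : ℂ) • Ω) (c * δ) ((c : ℂ) • A) = discreteArc Ω δ A := by
  have hc' : (c : ℂ) ≠ 0 := Complex.ofReal_ne_zero.2 hc.ne'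
  have hn : ‖(c : ℂ)‖ = c := by rw [Complex.norm_real, Real.norm_of_nonneg hc.le]
  ext x
  rw [mem_discreteArc_iff, mem_discreteArc_iff, meshBoundary_smul hc.ne', frontier_smul hc',
    ← smul_set_diff hc', meshPoint_mul, infDist_smul hc', infDist_smul hc', hn]
  exact and_congr_right fun _ ↦ mul_le_mul_iff_right₀ hc

/-- **Smirnov's crossing event is exactly dilation covariant**:
`C_{cδ}(cΩ; cA, cB) = C_δ(Ω; A, B)` as events on bond configurations of `ℤ²`. [folklore] -/
theorem discreteCrossing_smul (hc : 0 < c) (Ω : Set ℂ) (δ : ℝ) (A B : Set ℂ) :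
    discreteCrossing ((c : ℂ) • Ω) (c * δ) ((c : ℂ) • A) ((c : ℂ) • B) =
      discreteCrossing Ω δ A B := by
  ext ω
  rw [mem_discreteCrossing_iff, mem_discreteCrossing_iff, discreteArc_smul hc,
    discreteArc_smul hc, discreteDomainGraph_smul hc.ne']

/-! ### Dilated conformal rectangles -/

/-- `z ↦ c z` is holomorphic. [folklore] -/
theorem differentiableOn_mul_left (c : ℂ) (s : Set ℂ) : DifferentiableOn ℂ (fun z ↦ c * z) s :=
  (differentiable_id.const_mul c).differentiableOn

/-- `z ↦ c z` is injective for `c ≠ 0`. [folklore] -/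
theorem injOn_mul_left {c : ℂ} (hc : c ≠ 0) (s : Set ℂ) : InjOn (fun z ↦ c * z) s :=
  (mul_right_injective₀ hc).injOn

/-- **The bond-`ℤ²` crossing probability is exactly dilation covariant**: for the dilated
conformal rectangle `cR = (cΩ; ca, cb, cc, cd)` (`MarkedDomain.imageUnivalent` of `z ↦ c z`),
`P_{1/2}[C_{cδ}(cR)] = P_{1/2}[C_δ(R)]`. [folklore] -/
theorem bondDomainCrossingProb_dilate' (R : ConformalRectangle) (hc : 0 < c)
    {hd : DifferentiableOn ℂ (fun z ↦ (c : ℂ) * z) (closure R.carrier)}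
    {hi : InjOn (fun z ↦ (c : ℂ) * z) (closure R.carrier)} (δ : ℝ) :
    bondDomainCrossingProb (R.imageUnivalent (fun z ↦ (c : ℂ) * z) hd hi) (c * δ) =
      bondDomainCrossingProb R δ := by
  rw [bondDomainCrossingProb_eq_measureReal, bondDomainCrossingProb_eq_measureReal,
    MarkedDomain.carrier_imageUnivalent, MarkedDomain.arc_imageUnivalent,
    MarkedDomain.arc_imageUnivalent, ← smul_set_eq_image, ← smul_set_eq_image,
    ← smul_set_eq_image, discreteCrossing_smul hc]

/-- **The bond-`ℤ²` crossing probability is exactly dilation covariant** (registered form of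
`bondDomainCrossingProb_dilate'`, stub of item stmt-CriticalPhenomena-18184):
`P_{1/2}[C_{cδ}(cR)] = P_{1/2}[C_δ(R)]`. [folklore] -/
theorem bondDomainCrossingProb_dilate : ∀ {c : ℝ} (R : Literature.Probability.RandomPlanarGeometry.ConformalRectangle), 0 < c → ∀ {hd : DifferentiableOn ℂ (fun z : ℂ => (c : ℂ) * z) (closure R.carrier)} {hi : Set.InjOn (fun z : ℂ => (c : ℂ) * z) (closure R.carrier)} (δ : ℝ), Literature.Probability.Percolation.bondDomainCrossingProb (R.imageUnivalent (fun z : ℂ => (c : ℂ) * z) hd hi) (c * δ) = Literature.Probability.Percolation.bondDomainCrossingProb R δ := by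
  intro c R hc hd hi δ
  exact bondDomainCrossingProb_dilate' R hc δ

/-- The boundary loop of the dilated rectangle is the dilated loop. [folklore] -/
theorem boundary_dilate (R : ConformalRectangle) (c : ℂ)
    {hd : DifferentiableOn ℂ (fun z ↦ c * z) (closure R.carrier)}
    {hi : InjOn (fun z ↦ c * z) (closure R.carrier)} (u : ℝ) :
    (R.imageUnivalent (fun z ↦ c * z) hd hi).boundary u = c * R.boundary u := rfl

/-- The dilated rectangle keeps the mark parameters. [folklore] -/
theorem mark_dilate (R : ConformalRectangle) (c : ℂ)
    {hd : DifferentiableOn ℂ (fun z ↦ c * z) (closure R.carrier)}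
    {hi : InjOn (fun z ↦ c * z) (closure R.carrier)} (i : Fin 4) :
    (R.imageUnivalent (fun z ↦ c * z) hd hi).mark i = R.mark i := rfl

/-! ### The lattice-polygon class: mesh refinement -/

/-- A lattice segment of `hℤ²` is a union of `N` consecutive lattice segments of `(h/N)ℤ²`.
[folklore] -/
theorem segment_subset_iUnion_refine {h : ℝ} {N : ℕ} (hN : 0 < N) (u v : Site 2) :
    segment ℝ (meshPoint h u) (meshPoint h v) ⊆ ⋃ j ∈ Finset.range N,
      segment ℝ (meshPoint (h / N) ((N : ℤ) • u + (j : ℤ) • (v - u)))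
        (meshPoint (h / N) ((N : ℤ) • u + ((j : ℤ) + 1) • (v - u))) := by
  intro z hz
  rw [segment_eq_image'] at hz
  obtain ⟨t, ⟨ht0, ht1⟩, rfl⟩ := hz
  have hNr : (0 : ℝ) < N := by exact_mod_cast hN
  -- the index of the sub-segment containing the parameter `t`
  set j : ℕ := min ⌊t * N⌋₊ (N - 1) with hj
  have hjN : j < N := by rw [hj]; omega
  have hjt : (j : ℝ) ≤ t * N := by
    have h1 : ((min ⌊t * N⌋₊ (N - 1) : ℕ) : ℝ) ≤ ⌊t * N⌋₊ := by exact_mod_cast min_le_left _ _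
    exact h1.trans (Nat.floor_le (by positivity))
  have hjt' : t * N ≤ (j : ℝ) + 1 := by
    by_cases hfl : ⌊t * N⌋₊ ≤ N - 1
    · have : j = ⌊t * N⌋₊ := by rw [hj]; exact min_eq_left hfl
      rw [this]
      exact (Nat.lt_floor_add_one _).le
    · have : j = N - 1 := by rw [hj]; exact min_eq_right (by omega)
      rw [this, Nat.cast_sub (by omega), Nat.cast_one, sub_add_cancel]
      nlinarith
  simp only [mem_iUnion, Finset.mem_range]
  refine ⟨j, hjN, ?_⟩
  rw [segment_eq_image']
  refine ⟨t * N - j, ⟨by linarith, by linarith⟩, ?_⟩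
  -- coordinates
  apply Complex.ext
  · simp only [meshPoint_re, Complex.add_re, Complex.sub_re, Complex.real_smul,
      Complex.mul_re, Complex.ofReal_re, Complex.ofReal_im, zero_mul, sub_zero, Pi.add_apply,
      Pi.smul_apply, Pi.sub_apply, smul_eq_mul, Int.cast_add, Int.cast_mul, Int.cast_natCast,
      Int.cast_sub, Int.cast_one]
    field_simp
    ring
  · simp only [meshPoint_im, Complex.add_im, Complex.sub_im, Complex.real_smul,
      Complex.mul_im, Complex.ofReal_re, Complex.ofReal_im, zero_mul, add_zero, Pi.add_apply,
      Pi.smul_apply, Pi.sub_apply, smul_eq_mul, Int.cast_add, Int.cast_mul, Int.cast_natCast,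
      Int.cast_sub, Int.cast_one]
    field_simp
    ring

/-- Consecutive points of a refined lattice segment are nearest neighbours of `ℤ²`. [folklore] -/
theorem adj_refine {N : ℕ} {u v : Site 2} (huv : (zdGraph 2).Adj u v) (j : ℤ) :
    (zdGraph 2).Adj ((N : ℤ) • u + j • (v - u)) ((N : ℤ) • u + (j + 1) • (v - u)) := by
  rw [zdGraph_adj_iff] at huv ⊢
  obtain ⟨i, hi | hi⟩ := huv
  · refine ⟨i, Or.inl ?_⟩
    rw [hi, add_sub_cancel_left, add_smul, one_smul, add_assoc]
  · refine ⟨i, Or.inr ?_⟩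
    rw [hi, show v - (v + Pi.single i 1) = -Pi.single i 1 by abel, add_smul, one_smul]
    abel

/-- **Mesh refinement of the lattice-polygon class**: a conformal rectangle whose frontier is
covered by finitely many edges of `hℤ²` has its frontier covered by finitely many edges of
`(h/N)ℤ²`, `N ≥ 1`. [folklore] -/
theorem latticePolygon_refine (R : ConformalRectangle) {h : ℝ} {N : ℕ} (hN : 0 < N)
    (hS : ∃ S : Finset (ℂ × ℂ), (∀ p ∈ S, ∃ u v : Site 2, (zdGraph 2).Adj u v ∧
        p.1 = meshPoint h u ∧ p.2 = meshPoint h v) ∧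
      frontier R.carrier ⊆ ⋃ p ∈ S, segment ℝ p.1 p.2) :
    ∃ S : Finset (ℂ × ℂ), (∀ p ∈ S, ∃ u v : Site 2, (zdGraph 2).Adj u v ∧
        p.1 = meshPoint (h / N) u ∧ p.2 = meshPoint (h / N) v) ∧
      frontier R.carrier ⊆ ⋃ p ∈ S, segment ℝ p.1 p.2 := by
  classical
  obtain ⟨S, hS, hcov⟩ := hS
  choose! fu fv hadj h1 h2 using hS
  refine ⟨(S ×ˢ Finset.range N).image fun q ↦
      (meshPoint (h / N) ((N : ℤ) • fu q.1 + (q.2 : ℤ) • (fv q.1 - fu q.1)),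
        meshPoint (h / N) ((N : ℤ) • fu q.1 + ((q.2 : ℤ) + 1) • (fv q.1 - fu q.1))), ?_, ?_⟩
  · intro p hp
    obtain ⟨q, hq, rfl⟩ := Finset.mem_image.1 hp
    obtain ⟨hq1, -⟩ := Finset.mem_product.1 hq
    exact ⟨_, _, adj_refine (hadj q.1 hq1) _, rfl, rfl⟩
  · intro z hz
    have hz' := hcov hz
    simp only [mem_iUnion] at hz' ⊢
    obtain ⟨p, hp, hzp⟩ := hz'
    rw [h1 p hp, h2 p hp] at hzp
    have := segment_subset_iUnion_refine (h := h) hN (fu p) (fv p) hzp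
    simp only [mem_iUnion, Finset.mem_range] at this
    obtain ⟨j, hj, hzj⟩ := this
    exact ⟨_, Finset.mem_image.2 ⟨(p, j), Finset.mem_product.2 ⟨hp, Finset.mem_range.2 hj⟩, rfl⟩,
      hzj⟩

end DyadicLattice

end Summit.CriticalPhenomena.CardyFormulaZ2.Theorems
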